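import Summits.BirchSwinnertonDyer.Rank1Residual.GaloisImage.IdentityComponentLocalTwist
import Summits.BirchSwinnertonDyer.Rank1Residual.GaloisImage.CongruenceVisibilityTwistedWitnessRootsOfUnity
import Literature.NumberTheory.EllipticCurves.LocalPointsIntegersSubgroup
import HarnessLib

/-!
# Visibility of `Ш[3]` at additive `3` WITHOUT local certificates: the record shape fed by
# THEOREM A on both curves (cell `b2b-bsdres`, team n1011, seat p10 GEN 8; FILE 8b = THEOREM B of
# `HOME/b2b-bsdres-n1011-p10/g8/L41-NOTE.md`)

HONEST FRAMING (cell `b2b-bsdres`, run/shared/lean/b2b/bsd-rank1-residual/, verbatim in every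
file): the goal of the cell is to DELETE the COMBINATION-SHAPED residual classes of the
Birch–Swinnerton-Dyer formula for ALL analytic-rank `≤ 1` elliptic curves over `ℚ` — "full BSD
formula for every rank `≤ 1` curve in class `C`" assembled STRICTLY from published theorems — so
that the rank-`≤ 1` remainder becomes exactly the CONSTRUCTION-SHAPED classes, which are TYPED
(missing-input `Prop`s), NOT attempted. This is not "finishing BSD". Team n1011 (N10 / N11):
research route on the CONSTRUCTION-SHAPED class X4 (§I N11 LOWER half); no claim beyond the stated
classes; nothing is booked; marks UNCHANGED. Theorems only: no definition, no named fact, no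
`sorry`. RECORD-SHAPE theorem; it closes nothing by itself.

## What

`exists_sha_ne_zero_of_congr_of_identityComponent`: for `3`-congruent `E = W`, `E' = W'` over a
number field `K` and a place `v₀ ∣ 3` with `#(𝓞_{v₀}/3) = 3` and the three `ℚ₃`-facts (`−23` square,
`−3` non-square, `X³ − X − 1` rootless in `K_{v₀}`; over `ℚ` at `3`: FILE 5 / the wrapper
`CongruenceVisibilityIdentityComponentRat`) (`θ : E'[3] ⥲ E[3]`), `E(K)` finite of order prime to `3`, two points `P₁, P₂ ∈ E'(K)`
independent modulo `3E'(K)`, local conditions agreeing along `θ` at every `v ∈ S ∖ {v₀}`, and at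
`v₀`: `#E(K_{v₀})[3] = #E'(K_{v₀})[3] = 3`, and for each curve an integral model at `v₀` with CUSPIDAL
reduction together with a `3`-torsion point `(a₀, b₀)` of NONSINGULAR reduction on it (additive
reduction, `T ∈ E₀`: "σ = E0") — **then `Ш(E/K)[3] ≠ 0`.** No `𝓞_{v₀}[α]`-certificate is needed: the
binders `Q', Q₁` of the unramified-cubic record shape (FILE 6) are DISCHARGED by THEOREM A
(FILE 8a) on `E` and `E'`, the witness `P = c₁P₁ + c₂P₂` being found by pigeonhole in
`E'(K_{v₀})/(3E'(K_{v₀}) + ℤ·3Q₀')`, a group of order `≤ 4 < 9` (`#E'(K_{v₀})/3 = #E'(K_{v₀})[3]·#(𝓞_{v₀}/3) = 9`,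
tree `card_quotient_range_nsmul_adicCompletion`; `3Q₀' ∉ 3E'(K_{v₀})` because a `Stab(α)`-fixed
`3`-torsion point is `Γ`-fixed, FILE 3).

References: [CremonaMazur2000] §3; [MilneADT2006] I.3.3, I.3.8; L41-NOTE §§1–2 (THEOREMS A, B).
-/

noncomputable section

open scoped Classical

namespace Summit.BirchSwinnertonDyer.Rank1Residual.GaloisImage.TwistedWitness

open WeierstrassCurve Literature.NumberTheory.EllipticCurves Literature.NumberTheory.GaloisRepresentations
open Field NumberField IsDedekindDomain IsDedekindDomain.HeightOneSpectrum


set_option maxHeartbeats 1600000 in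
/-- **THEOREM B as a record shape (certificate-free at `3`).** See the module docstring.
[cite: CremonaMazur2000, §3 pp. 19–22] [cite: MilneADT2006, Ch. I Prop. 3.8 and Lemma 3.3] -/
theorem exists_sha_ne_zero_of_congr_of_identityComponent {K : Type} [Field K] [NumberField K]
    (W W' : WeierstrassCurve K) [W.IsElliptic] [W'.IsElliptic]
    (θ : geomTorsion W' ((3 : ℕ) : ℤ) ≃+ geomTorsion W ((3 : ℕ) : ℤ))
    (hθ : ∀ (σ : absoluteGaloisGroup K) (P : geomTorsion W' ((3 : ℕ) : ℤ)), θ (σ • P) = σ • θ P)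
    (S : Finset (HeightOneSpectrum (𝓞 K)))
    (hS : ∀ v : HeightOneSpectrum (𝓞 K), v ∉ S →
      W.HasGoodReductionAt v ∧ W'.HasGoodReductionAt v ∧ ((3 : ℕ) : 𝓞 K) ∉ v.asIdeal)
    (hfin : Finite W.toAffine.Point) (hcop : (Nat.card W.toAffine.Point).Coprime 3)
    (P₁ P₂ : W'.toAffine.Point)
    (hind : ∀ c₁ c₂ : ℤ, c₁ • P₁ + c₂ • P₂ ∈
      (zsmulAddGroupHom ((3 : ℕ) : ℤ) : W'.toAffine.Point →+ W'.toAffine.Point).range →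
      (3 : ℤ) ∣ c₁ ∧ (3 : ℤ) ∣ c₂)
    (v₀ : HeightOneSpectrum (𝓞 K)) (h3v : ((3 : ℕ) : 𝓞 K) ∈ v₀.asIdeal)
    (hO3 : Nat.card (v₀.adicCompletionIntegers K ⧸
      Ideal.span {((3 : ℕ) : v₀.adicCompletionIntegers K)}) = 3)
    {δ : v₀.adicCompletion K} (hδ : δ ^ 2 = -23)
    (hnoroot : ∀ x : v₀.adicCompletion K, x ^ 3 - x - 1 ≠ 0)
    (hn3 : ∀ y : v₀.adicCompletion K, y ^ 2 ≠ -3)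
    (hoff : ∀ v ∈ S, v ≠ v₀ →
      (selmerLocalKer W (v.adicCompletion K) ((3 : ℕ) : ℤ)).relIndex
        ((selmerLocalKer W' (v.adicCompletion K) ((3 : ℕ) : ℤ)).map (h1Equiv θ hθ).toAddMonoidHom) = 1)
    (hcard : Nat.card (nsmulAddMonoidHom 3 :
      (W.baseChange (v₀.adicCompletion K)).toAffine.Point →+ _).ker = 3)
    (hcard' : Nat.card (nsmulAddMonoidHom 3 :
      (W'.baseChange (v₀.adicCompletion K)).toAffine.Point →+ _).ker = 3)
    -- identity-component data for `E` at `v₀`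
    (M : WeierstrassCurve (v₀.adicCompletionIntegers K)) (C : VariableChange (v₀.adicCompletion K))
    (hC : C • W.baseChange (v₀.adicCompletion K) =
      M.map (algebraMap (v₀.adicCompletionIntegers K) (v₀.adicCompletion K)))
    (x₀ y₀ a : IsLocalRing.ResidueField (v₀.adicCompletionIntegers K))
    (hcusp : M.map (IsLocalRing.residue (v₀.adicCompletionIntegers K)) = singularModel x₀ y₀ a a)
    {a₀ b₀ : v₀.adicCompletionIntegers K}
    (hns₀ : (M.map (IsLocalRing.residue (v₀.adicCompletionIntegers K))).toAffine.Nonsingular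
      (IsLocalRing.residue (v₀.adicCompletionIntegers K) a₀)
      (IsLocalRing.residue (v₀.adicCompletionIntegers K) b₀))
    (hm : ((M.map (algebraMap (v₀.adicCompletionIntegers K) (v₀.adicCompletion K))).baseChange
        (AlgebraicClosure (v₀.adicCompletion K))).toAffine.Nonsingular
      (algebraMap (v₀.adicCompletionIntegers K) (AlgebraicClosure (v₀.adicCompletion K)) a₀)
      (algebraMap (v₀.adicCompletionIntegers K) (AlgebraicClosure (v₀.adicCompletion K)) b₀))
    (h3 : (3 : ℤ) • (Affine.Point.some _ _ hm :
      ((M.map (algebraMap (v₀.adicCompletionIntegers K) (v₀.adicCompletion K))).baseChange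
        (AlgebraicClosure (v₀.adicCompletion K))).toAffine.Point) = 0)
    -- identity-component data for `E'` at `v₀`
    (M' : WeierstrassCurve (v₀.adicCompletionIntegers K)) (C' : VariableChange (v₀.adicCompletion K))
    (hC' : C' • W'.baseChange (v₀.adicCompletion K) =
      M'.map (algebraMap (v₀.adicCompletionIntegers K) (v₀.adicCompletion K)))
    (x₀' y₀' a' : IsLocalRing.ResidueField (v₀.adicCompletionIntegers K))
    (hcusp' : M'.map (IsLocalRing.residue (v₀.adicCompletionIntegers K)) = singularModel x₀' y₀' a' a')
    {a₀' b₀' : v₀.adicCompletionIntegers K}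
    (hns₀' : (M'.map (IsLocalRing.residue (v₀.adicCompletionIntegers K))).toAffine.Nonsingular
      (IsLocalRing.residue (v₀.adicCompletionIntegers K) a₀')
      (IsLocalRing.residue (v₀.adicCompletionIntegers K) b₀'))
    (hm' : ((M'.map (algebraMap (v₀.adicCompletionIntegers K) (v₀.adicCompletion K))).baseChange
        (AlgebraicClosure (v₀.adicCompletion K))).toAffine.Nonsingular
      (algebraMap (v₀.adicCompletionIntegers K) (AlgebraicClosure (v₀.adicCompletion K)) a₀')
      (algebraMap (v₀.adicCompletionIntegers K) (AlgebraicClosure (v₀.adicCompletion K)) b₀'))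
    (h3' : (3 : ℤ) • (Affine.Point.some _ _ hm' :
      ((M'.map (algebraMap (v₀.adicCompletionIntegers K) (v₀.adicCompletion K))).baseChange
        (AlgebraicClosure (v₀.adicCompletion K))).toAffine.Point) = 0) :
    ∃ c : W.sha, c ≠ 0 ∧ 3 • c = 0 := by
  haveI : Fact (Nat.Prime 3) := ⟨Nat.prime_three⟩
  haveI : CharZero (v₀.adicCompletion K) := Literature.NumberTheory.GaloisRepresentations.charZero_adicCompletion v₀
  -- the cubic field data at `v₀`
  obtain ⟨α, hα⟩ := exists_cubicRoot (v₀.adicCompletion K)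
  set H := MulAction.stabilizer (absoluteGaloisGroup (v₀.adicCompletion K)) α with hHdef
  haveI hHn : H.Normal := normal_stabilizer_cubicRoot hα hδ
  have hHi : H.index = 3 := index_stabilizer_cubicRoot hα hδ hnoroot
  have hmemH : ∀ σ : absoluteGaloisGroup (v₀.adicCompletion K), σ ∈ H ↔ σ • α = α := fun σ ↦
    MulAction.mem_stabilizer_iff
  obtain ⟨F₀, hF₀H⟩ := exists_smul_cubicRoot_ne hα hδ hnoroot
  have hF₀ : F₀ • α ≠ α := fun h ↦ hF₀H ((hmemH F₀).mpr h)
  have hgen := exists_pow_mul_of_index_eq_prime H hHi hF₀H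
  have hF3 : F₀ ^ 3 ∈ H := by rw [← hHi]; exact Subgroup.pow_index_mem H F₀
  have hζ := exists_mem_stabilizer_smul_ne_of_cube_eq_one hα hδ hnoroot hn3
  -- THEOREM A on `E`: the binders `Q₁`
  obtain ⟨Q₁, T₁, hT₁0, -, -, hQ₁H, hQ₁F, hQ₁3⟩ :=
    exists_localPoints_twist_of_identityComponent W h3v M C hC x₀ y₀ a hcusp hα hδ hnoroot F₀ hF₀ hns₀ hm h3
  -- THEOREM A on `E'`: `Q₀'` and `R' = 3 • Q₀'`
  obtain ⟨Q₀', T', hT'0, hT'3, -, hQ₀'H, hQ₀'F, hQ₀'3⟩ :=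
    exists_localPoints_twist_of_identityComponent W' h3v M' C' hC' x₀' y₀' a' hcusp' hα hδ hnoroot F₀ hF₀
      hns₀' hm' h3'
  -- `K_v`-points of `E'` read in `E'(K̄_v)`
  set ψ : (W'.baseChange (v₀.adicCompletion K)).toAffine.Point →+ localPoints W' (v₀.adicCompletion K) :=
    (W'.baseChangeGeomPointsEquiv (v₀.adicCompletion K)).toAddMonoidHom.comp (toGeomPoints (W'.baseChange (v₀.adicCompletion K))) with hψdef
  have hψ : ∀ R, ψ R = W'.baseChangeGeomPointsEquiv (v₀.adicCompletion K) (toGeomPoints (W'.baseChange (v₀.adicCompletion K)) R) := fun R ↦ rfl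
  have hψfix : ∀ R (σ : absoluteGaloisGroup (v₀.adicCompletion K)), σ • ψ R = ψ R := fun R σ ↦
    VisibleWitness.baseChangeGeomPointsEquiv_toGeomPoints_mem_fixedPoints W' (v₀.adicCompletion K) R σ
  have hψsurj : ∀ T : localPoints W' (v₀.adicCompletion K), (∀ σ : absoluteGaloisGroup (v₀.adicCompletion K), σ • T = T) → ∃ R, ψ R = T := by
    intro T hT
    have hfix : (W'.baseChangeGeomPointsEquiv (v₀.adicCompletion K)).symm T ∈
        MulAction.fixedPoints (absoluteGaloisGroup (v₀.adicCompletion K)) (geomPoints (W'.baseChange (v₀.adicCompletion K))) := fun σ ↦ by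
      rw [← baseChangeGeomPointsEquiv_symm_smul, hT σ]
    obtain ⟨R, hR⟩ := (mem_range_toGeomPoints_iff (W'.baseChange (v₀.adicCompletion K)) _).mpr hfix
    exact ⟨R, by rw [hψ, hR, AddEquiv.apply_symm_apply]⟩
  obtain ⟨R', hR'⟩ := hψsurj ((3 : ℤ) • Q₀') hQ₀'3
  -- `R' ∉ 3 E'(K_v)`: a `Stab(α)`-fixed `3`-torsion point is `Γ`-fixed (FILE 3), but `F₀` moves `Q₀'`
  have hR'not : R' ∉ (nsmulAddMonoidHom 3 : (W'.baseChange (v₀.adicCompletion K)).toAffine.Point →+ _).range := by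
    rintro ⟨S₀, hS₀⟩
    rw [nsmulAddMonoidHom_apply] at hS₀
    have hψS₀ : ((3 : ℕ) : ℤ) • ψ S₀ = (3 : ℤ) • Q₀' := by
      rw [natCast_zsmul, ← map_nsmul, hS₀, hR']
    have hD3 : ((3 : ℕ) : ℤ) • (Q₀' - ψ S₀) = 0 := by
      rw [zsmul_sub, hψS₀, sub_eq_zero]
      norm_num
    have hDH : ∀ h ∈ H, h • (Q₀' - ψ S₀) = Q₀' - ψ S₀ := fun h hh ↦ by
      rw [smul_sub, hQ₀'H h ((hmemH h).mp hh), hψfix]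
    have hDF := smul_eq_of_torsion_of_fixed_of_rootsOfUnity W' (v₀.adicCompletion K) (p := 3) H hHn F₀
      hgen hF3 hζ (Q₀' - ψ S₀) hD3 hDH F₀
    rw [smul_sub, hψfix, sub_left_inj] at hDF
    apply hT'0
    rw [← hQ₀'F, hDF, sub_self]
  -- `#(E'(K_v)/3) = 9`
  set R3 : AddSubgroup (W'.baseChange (v₀.adicCompletion K)).toAffine.Point :=
    (nsmulAddMonoidHom 3 : (W'.baseChange (v₀.adicCompletion K)).toAffine.Point →+ _).range with hR3
  have hR3idx : R3.index = 9 := by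
    rw [hR3, AddSubgroup.index, W'.card_quotient_range_nsmul_adicCompletion v₀ (by norm_num : (3 : ℕ) ≠ 0),
      hcard', hO3]
  -- the subgroup `N = 3E'(K_v) + ℤ R'` has index `≤ 4`
  set N : AddSubgroup (W'.baseChange (v₀.adicCompletion K)).toAffine.Point := R3 ⊔ AddSubgroup.zmultiples R' with hN
  have hle : R3 ≤ N := le_sup_left
  have hNidx : N.index < 9 ∧ N.index ≠ 0 := by
    have hmul := AddSubgroup.relIndex_mul_index hle
    rw [hR3idx] at hmul
    have hne1 : R3.relIndex N ≠ 1 := by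
      rw [Ne, AddSubgroup.relIndex_eq_one]
      intro hNle
      exact hR'not (hNle (AddSubgroup.mem_sup_right (AddSubgroup.mem_zmultiples R')))
    refine ⟨?_, fun h0 ↦ by rw [h0, mul_zero] at hmul; exact absurd hmul (by norm_num)⟩
    by_contra hge
    rw [not_lt] at hge
    have hpos : 1 ≤ R3.relIndex N := by
      by_contra h0; rw [not_le, Nat.lt_one_iff] at h0; rw [h0, zero_mul] at hmul; exact absurd hmul (by norm_num)
    have : R3.relIndex N = 1 := by nlinarith
    exact hne1 this
  haveI : N.FiniteIndex := ⟨hNidx.2⟩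
  haveI : Finite ((W'.baseChange (v₀.adicCompletion K)).toAffine.Point ⧸ N) := AddSubgroup.finite_quotient_of_finiteIndex
  letI : Fintype ((W'.baseChange (v₀.adicCompletion K)).toAffine.Point ⧸ N) := Fintype.ofFinite _
  -- the generators read in `E'(K_v)` (as `K_v`-points) and the pigeonhole
  have hPfix : ∀ (Q : W'.toAffine.Point) (σ : absoluteGaloisGroup (v₀.adicCompletion K)),
      σ • pointsMap W' (v₀.adicCompletion K) (toGeomPoints W' Q) =
        pointsMap W' (v₀.adicCompletion K) (toGeomPoints W' Q) := fun Q σ ↦ by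
    rw [← pointsMap_smul, toGeomPoints_mem_fixedPoints W' Q]
  obtain ⟨P₁L, hP₁L⟩ := hψsurj _ (hPfix P₁)
  obtain ⟨P₂L, hP₂L⟩ := hψsurj _ (hPfix P₂)
  set f : ℕ × ℕ → (W'.baseChange (v₀.adicCompletion K)).toAffine.Point ⧸ N :=
    fun ab ↦ QuotientAddGroup.mk (((ab.1 : ℕ) : ℤ) • P₁L + ((ab.2 : ℕ) : ℤ) • P₂L) with hf
  have hcardlt : (Finset.univ : Finset ((W'.baseChange (v₀.adicCompletion K)).toAffine.Point ⧸ N)).card <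
      (Finset.range 3 ×ˢ Finset.range 3).card := by
    rw [Finset.card_univ, Finset.card_product, Finset.card_range, ← Nat.card_eq_fintype_card,
      ← AddSubgroup.index_eq_card]
    exact hNidx.1
  obtain ⟨x, hx, y, hy, hxy, hfxy⟩ := Finset.exists_ne_map_eq_of_card_lt_of_maps_to hcardlt
    (f := f) (fun _ _ ↦ Finset.mem_univ _)
  rw [Finset.mem_product, Finset.mem_range, Finset.mem_range] at hx hy
  rw [hf, QuotientAddGroup.eq] at hfxy
  -- `c₁ = y.1 - x.1`, `c₂ = y.2 - x.2`: not both divisible by `3`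
  set c₁ : ℤ := (y.1 : ℤ) - x.1 with hc₁
  set c₂ : ℤ := (y.2 : ℤ) - x.2 with hc₂
  have hnotdvd : ¬ ((3 : ℤ) ∣ c₁ ∧ (3 : ℤ) ∣ c₂) := by
    rintro ⟨h₁, h₂⟩
    apply hxy
    have hx1 : (x.1 : ℤ) < 3 := by exact_mod_cast hx.1
    have hx2 : (x.2 : ℤ) < 3 := by exact_mod_cast hx.2
    have hy1 : (y.1 : ℤ) < 3 := by exact_mod_cast hy.1
    have hy2 : (y.2 : ℤ) < 3 := by exact_mod_cast hy.2
    have h0x1 : (0 : ℤ) ≤ x.1 := Int.natCast_nonneg _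
    have h0x2 : (0 : ℤ) ≤ x.2 := Int.natCast_nonneg _
    have h0y1 : (0 : ℤ) ≤ y.1 := Int.natCast_nonneg _
    have h0y2 : (0 : ℤ) ≤ y.2 := Int.natCast_nonneg _
    have z1 : c₁ = 0 := Int.eq_zero_of_abs_lt_dvd h₁ (by rw [hc₁, abs_lt]; constructor <;> linarith)
    have z2 : c₂ = 0 := Int.eq_zero_of_abs_lt_dvd h₂ (by rw [hc₂, abs_lt]; constructor <;> linarith)
    have e1 : x.1 = y.1 := by
      have : (x.1 : ℤ) = y.1 := by rw [hc₁] at z1; linarith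
      exact_mod_cast this
    have e2 : x.2 = y.2 := by
      have : (x.2 : ℤ) = y.2 := by rw [hc₂] at z2; linarith
      exact_mod_cast this
    exact Prod.ext e1 e2
  have hmemN : c₁ • P₁L + c₂ • P₂L ∈ N := by
    have e : c₁ • P₁L + c₂ • P₂L =
        -(((x.1 : ℕ) : ℤ) • P₁L + ((x.2 : ℕ) : ℤ) • P₂L) + (((y.1 : ℕ) : ℤ) • P₁L + ((y.2 : ℕ) : ℤ) • P₂L) := by
      rw [hc₁, hc₂]; module
    rw [e]; exact hfxy
  -- decompose in `N = 3E'(K_v) + ℤ R'`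
  obtain ⟨y₃, hy₃, z, hz, hsum⟩ := AddSubgroup.mem_sup.mp hmemN
  obtain ⟨S₁, rfl⟩ := hy₃
  obtain ⟨k, rfl⟩ := AddSubgroup.mem_zmultiples_iff.mp hz
  rw [nsmulAddMonoidHom_apply] at hsum
  -- the global witness
  set P : W'.toAffine.Point := c₁ • P₁ + c₂ • P₂ with hPdef
  have hP : P ∉ (zsmulAddGroupHom ((3 : ℕ) : ℤ) : W'.toAffine.Point →+ W'.toAffine.Point).range :=
    fun hmem ↦ hnotdvd (hind c₁ c₂ hmem)
  -- the `Stab(α)`-fixed cube root `Q'` of `P` in `E'(K̄_v)`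
  set Q' : localPoints W' (v₀.adicCompletion K) := ψ S₁ + k • Q₀' with hQ'def
  -- (`W'.toAffine.Point` carries `K`'s decidable equality here, the tree's `toGeomPoints` the
  -- classical one: the two group laws agree, `Subsingleton (DecidableEq K)`.)
  have eP : toGeomPoints W' P = c₁ • toGeomPoints W' P₁ + c₂ • toGeomPoints W' P₂ := by
    rw [hPdef, map_add, map_zsmul, map_zsmul]
  have e1 : pointsMap W' (v₀.adicCompletion K) (toGeomPoints W' P) = c₁ • ψ P₁L + c₂ • ψ P₂L := by
    rw [eP, map_add, map_zsmul, map_zsmul, hP₁L, hP₂L]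
  have e2 : c₁ • ψ P₁L + c₂ • ψ P₂L = ψ (c₁ • P₁L + c₂ • P₂L) := by
    rw [map_add, map_zsmul, map_zsmul]
  have e3 : ψ (c₁ • P₁L + c₂ • P₂L) = ((3 : ℕ) : ℤ) • ψ S₁ + k • ((3 : ℤ) • Q₀') := by
    rw [← hsum, map_add, map_nsmul, map_zsmul, hR', natCast_zsmul]
  have hQ' : ((3 : ℕ) : ℤ) • Q' = pointsMap W' (v₀.adicCompletion K) (toGeomPoints W' P) := by
    rw [e1, e2, e3, hQ'def]
    module
  have hQ'H : ∀ h : absoluteGaloisGroup (v₀.adicCompletion K), h • α = α → h • Q' = Q' := fun h hh ↦ by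
    rw [hQ'def, smul_add, hψfix, W'.smul_zsmul_localPoints, hQ₀'H h hh]
  -- the `E`-side binders
  have e33 : ((3 : ℕ) : ℤ) = 3 := by norm_num
  have hQ₁fix : ((3 : ℕ) : ℤ) • Q₁ ∈
      MulAction.fixedPoints (absoluteGaloisGroup (v₀.adicCompletion K)) (localPoints W (v₀.adicCompletion K)) := by
    rw [e33]; exact fun σ ↦ hQ₁3 σ
  exact exists_sha_ne_zero_of_congr_of_twistedDivisible_of_rootsOfUnity W W' (p := 3) (by norm_num) θ hθ S hS
    hfin hcop P hP v₀ (fun v hv hne ↦ Or.inr (hoff v hv hne)) H hHn hHi F₀ hF₀H hζ hcard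
    Q' (fun h hh ↦ hQ'H h ((hmemH h).mp hh)) hQ' Q₁ (fun h hh ↦ hQ₁H h ((hmemH h).mp hh)) hQ₁fix
    (fun h ↦ hT₁0 (by rw [← hQ₁F, h, sub_self]))

end Summit.BirchSwinnertonDyer.Rank1Residual.GaloisImage.TwistedWitness

end
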